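import Mathlib
import Summits.Ventures.PercRepro2.Defs
import Summits.Ventures.PercRepro2.Harris
import Summits.Ventures.PercRepro2.Graph
import Summits.Ventures.PercRepro2.Events
import Summits.Ventures.PercRepro2.KTwoFiveNegative
import Summits.Ventures.PercRepro2.THRefutation

/-!
# The corner family of witnesses against (T_h): an explicit polynomial in one parameter
(blind cell PercRepro2, mine-a g49)

On the 7-vertex graph `G` of `THRefutation` (edges `r–x₂, r–x₃, r–x₄, r–x₅, r–x₆, h–x₂, h–x₃,
x₂–x₄, x₃–x₅, x₄–x₆`, the single-vertex up-sets `𝓤 = {x₅ ∈ T}`, `𝓥 = {x₆ ∈ T}`) take the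
one-parameter weights `p_ε = 1 − ε` on the five root edges and `ε` on the other five.  Then the
three-event form is the polynomial
`T(ε) = −ε¹⁰ + 16ε¹¹ − 38ε¹² + 50ε¹³ − 53ε¹⁴ + 47ε¹⁵ − 36ε¹⁶ + 24ε¹⁷ − 13ε¹⁸ + 6ε¹⁹ − 2ε²⁰`
(`t_corner_eq`), which is negative for every `0 < ε ≤ 1/16` (`t_corner_neg`): an infinite family of
exact witnesses, e.g. `ε = 1/16` gives `−75314579025 / 2⁷⁹`.  The form vanishes to order `ε¹⁰`
at the corner — the order of the single negative antipodal base case `K_E = −1` — because every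
proper pinned base case of lower order vanishes there (MINE-A.md §104).
Route: the weight of a configuration is `ε^{dev ω} (1 − ε)^{10 − dev ω}` with `dev ω` the number of
edges deviating from the corner (`weight_eq`); a probability is `Σ_k n_k ε^k (1 − ε)^{10−k}` with the
integer counts `n_k = #{ω ∈ A : dev ω = k}` (`prob_eq`, a fibrewise sum), the seven count vectors by
`decide` over ten nested Boolean sums, and `ring` closes the polynomial identity.
No instance, no notation.
-/

namespace Summit.Ventures.PercRepro2

namespace THCornerFamily

open Finset THRefutation

/-- The corner: the five root edges open, the five other edges closed. -/
def corner : Fin 10 → Bool := ![true, true, true, true, true, false, false, false, false, false]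

/-- The deviation of edge `e` from the corner (`0` or `1`). -/
def devE (ω : Config (Fin 10)) (e : Fin 10) : ℕ := if ω e = corner e then 0 else 1

/-- The number of edges deviating from the corner, as an explicit ten-term sum. -/
def dev (ω : Config (Fin 10)) : ℕ :=
  devE ω 0 + devE ω 1 + devE ω 2 + devE ω 3 + devE ω 4 + devE ω 5 + devE ω 6 + devE ω 7
    + devE ω 8 + devE ω 9

/-- `dev` is the sum of the edge deviations. -/
lemma dev_eq_sum (ω : Config (Fin 10)) : dev ω = ∑ e, devE ω e := by
  simp only [Fin.sum_univ_succ, Fin.sum_univ_zero, dev, add_zero, Nat.add_assoc]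
  rfl

/-- Every edge deviation is at most `1`. -/
lemma devE_le_one (ω : Config (Fin 10)) (e : Fin 10) : devE ω e ≤ 1 := by
  unfold devE; split_ifs <;> omega

/-- The deviation count is at most `10`. -/
lemma dev_le (ω : Config (Fin 10)) : dev ω ≤ 10 := by
  unfold dev
  have := devE_le_one ω
  have h0 := this 0; have h1 := this 1; have h2 := this 2; have h3 := this 3; have h4 := this 4
  have h5 := this 5; have h6 := this 6; have h7 := this 7; have h8 := this 8; have h9 := this 9
  omega

/-- The corner family of weights: `1 − ε` on the root edges, `ε` on the others. -/
def pε (ε : ℚ) : Fin 10 → ℚ := fun e => if corner e then 1 - ε else ε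

/-- The corner weights are admissible for `0 ≤ ε ≤ 1`. -/
lemma isProbVec_pε (ε : ℚ) (h0 : 0 ≤ ε) (h1 : ε ≤ 1) : IsProbVec (pε ε) := by
  refine ⟨fun e => ?_, fun e => ?_⟩ <;> unfold pε <;> split_ifs <;> linarith

/-- The Bernoulli factor of an edge is `ε^{devE} (1 − ε)^{1 − devE}`. -/
lemma edgeFactor_eq (ε : ℚ) (ω : Config (Fin 10)) (e : Fin 10) :
    edgeFactor (pε ε e) (ω e) = ε ^ devE ω e * (1 - ε) ^ (1 - devE ω e) := by
  unfold edgeFactor pε devE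
  cases h : ω e <;> cases hc : corner e <;> simp

/-- **The weight of a configuration is `ε^{dev ω} (1 − ε)^{10 − dev ω}`.** -/
lemma weight_eq (ε : ℚ) (ω : Config (Fin 10)) :
    weight (pε ε) ω = ε ^ dev ω * (1 - ε) ^ (10 - dev ω) := by
  unfold weight
  simp only [edgeFactor_eq]
  rw [prod_mul_distrib, prod_pow_eq_pow_sum, prod_pow_eq_pow_sum, dev_eq_sum]
  congr 2
  rw [sum_tsub_distrib _ (fun e _ => devE_le_one ω e)]
  simp

/-- The number of configurations with deviation `k` satisfying the Boolean predicate `b`. -/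
def cnt (b : Config (Fin 10) → Bool) (k : ℕ) : ℕ :=
  (univ.filter (fun ω : Config (Fin 10) => dev ω = k ∧ b ω = true)).card

/-- **A probability in the corner family is `Σ_k n_k ε^k (1 − ε)^{10−k}`** with the integer counts
`n_k = cnt b k` (a fibrewise sum over the deviation). -/
lemma prob_eq (ε : ℚ) {A : Set (Config (Fin 10))} {b : Config (Fin 10) → Bool}
    (h : ∀ ω, ω ∈ A ↔ b ω = true) :
    prob (pε ε) A = ∑ k ∈ range 11, (cnt b k : ℚ) * (ε ^ k * (1 - ε) ^ (10 - k)) := by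
  unfold prob
  have hind : ∀ ω, A.indicator (weight (pε ε)) ω =
      if b ω = true then ε ^ dev ω * (1 - ε) ^ (10 - dev ω) else 0 := by
    intro ω
    by_cases hb : b ω = true
    · rw [Set.indicator_of_mem ((h ω).2 hb), if_pos hb, weight_eq]
    · rw [Set.indicator_of_notMem (fun hc => hb ((h ω).1 hc)), if_neg hb]
  simp only [hind]
  rw [← sum_fiberwise_of_maps_to (s := univ) (t := range 11) (g := dev)
    (fun ω _ => mem_range.2 (Nat.lt_succ_of_le (dev_le ω)))]
  refine sum_congr rfl fun k _ => ?_
  rw [sum_congr rfl (fun ω hω => by rw [(mem_filter.1 hω).2] :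
    ∀ ω ∈ univ.filter (fun ω => dev ω = k),
      (if b ω = true then ε ^ dev ω * (1 - ε) ^ (10 - dev ω) else 0) =
        if b ω = true then ε ^ k * (1 - ε) ^ (10 - k) else 0)]
  rw [sum_ite, sum_const_zero, add_zero, sum_const, filter_filter, nsmul_eq_mul]
  rfl

/-- Sums over `Fin (n + 1) → Bool` split along the first coordinate (natural-number version). -/
lemma sum_pi_succ_nat (n : ℕ) (g : (Fin (n + 1) → Bool) → ℕ) :
    ∑ ω, g ω = ∑ b : Bool, ∑ ω : Fin n → Bool, g (Fin.cons b ω) := by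
  rw [← Equiv.sum_comp (Fin.consEquiv fun _ => Bool) g, Fintype.sum_prod_type]
  rfl

/-- The count as a sum of indicators. -/
lemma cnt_eq_sum (b : Config (Fin 10) → Bool) (k : ℕ) :
    cnt b k = ∑ ω : Config (Fin 10), if dev ω = k ∧ b ω = true then 1 else 0 :=
  card_filter _ _

/-- The deviation counts of the hit event `Q = {h ∈ C_r}`: `0, 2, 15, 52, 107, 143, 127, 74, 26, 5, 0`. -/
lemma cnt_Q : (fun k : Fin 11 => cnt (fun ω => inC ω 1) k) =
    ![0, 2, 15, 52, 107, 143, 127, 74, 26, 5, 0] := by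
  simp (config := { maxSteps := 4000000 }) only [cnt_eq_sum, sum_pi_succ_nat]
  decide

/-- The deviation counts of the event `U = {x₅ ∈ C_r}`: `1, 9, 37, 91, 147, 162, 123, 64, 22, 5, 0`. -/
lemma cnt_U : (fun k : Fin 11 => cnt (fun ω => inC ω 5) k) =
    ![1, 9, 37, 91, 147, 162, 123, 64, 22, 5, 0] := by
  simp (config := { maxSteps := 4000000 }) only [cnt_eq_sum, sum_pi_succ_nat]
  decide

/-- The deviation counts of the event `e = {x₆ ∈ C_r}`: `1, 9, 37, 91, 148, 166, 129, 68, 23, 5, 0`. -/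
lemma cnt_E : (fun k : Fin 11 => cnt (fun ω => inC ω 6) k) =
    ![1, 9, 37, 91, 148, 166, 129, 68, 23, 5, 0] := by
  simp (config := { maxSteps := 4000000 }) only [cnt_eq_sum, sum_pi_succ_nat]
  decide

/-- The deviation counts of `Q ∩ U`: `0, 2, 13, 41, 79, 102, 89, 53, 19, 5, 0`. -/
lemma cnt_QU : (fun k : Fin 11 => cnt (fun ω => inC ω 1 && inC ω 5) k) =
    ![0, 2, 13, 41, 79, 102, 89, 53, 19, 5, 0] := by
  simp (config := { maxSteps := 4000000 }) only [cnt_eq_sum, sum_pi_succ_nat]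
  decide

/-- The deviation counts of `Q ∩ e`: `0, 2, 13, 41, 77, 96, 81, 48, 17, 5, 0`. -/
lemma cnt_QE : (fun k : Fin 11 => cnt (fun ω => inC ω 1 && inC ω 6) k) =
    ![0, 2, 13, 41, 77, 96, 81, 48, 17, 5, 0] := by
  simp (config := { maxSteps := 4000000 }) only [cnt_eq_sum, sum_pi_succ_nat]
  decide

/-- The deviation counts of `U ∩ e`: `1, 8, 30, 68, 102, 105, 74, 36, 10, 5, 0`. -/
lemma cnt_UE : (fun k : Fin 11 => cnt (fun ω => inC ω 5 && inC ω 6) k) =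
    ![1, 8, 30, 68, 102, 105, 74, 36, 10, 5, 0] := by
  simp (config := { maxSteps := 4000000 }) only [cnt_eq_sum, sum_pi_succ_nat]
  decide

/-- The deviation counts of `Q ∩ U ∩ e`: `0, 2, 11, 32, 56, 69, 56, 36, 10, 5, 0`. -/
lemma cnt_QUE : (fun k : Fin 11 => cnt (fun ω => inC ω 1 && inC ω 5 && inC ω 6) k) =
    ![0, 2, 11, 32, 56, 69, 56, 36, 10, 5, 0] := by
  simp (config := { maxSteps := 4000000 }) only [cnt_eq_sum, sum_pi_succ_nat]
  decide

/-- One count of a count vector. -/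
lemma cnt_val {b : Config (Fin 10) → Bool} {v : Fin 11 → ℕ}
    (h : (fun k : Fin 11 => cnt b k) = v) (k : Fin 11) : cnt b k = v k := congrFun h k

/-- A probability in the corner family with its count vector substituted. -/
lemma prob_eq_vec (ε : ℚ) {A : Set (Config (Fin 10))} {b : Config (Fin 10) → Bool}
    (h : ∀ ω, ω ∈ A ↔ b ω = true) {v : Fin 11 → ℕ} (hv : (fun k : Fin 11 => cnt b k) = v) :
    prob (pε ε) A = ∑ k : Fin 11, (v k : ℚ) * (ε ^ (k : ℕ) * (1 - ε) ^ (10 - (k : ℕ))) := by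
  rw [prob_eq ε h, sum_range]
  exact sum_congr rfl fun k _ => by rw [cnt_val hv k]

/-- **The three-event form of the corner family is the polynomial
`−ε¹⁰ + 16ε¹¹ − 38ε¹² + 50ε¹³ − 53ε¹⁴ + 47ε¹⁵ − 36ε¹⁶ + 24ε¹⁷ − 13ε¹⁸ + 6ε¹⁹ − 2ε²⁰`.** -/
theorem t_corner_eq (ε : ℚ) :
    let Q := clusterInEvent ends 0 {T : Set (Fin 7) | (1 : Fin 7) ∈ T}
    let U := clusterInEvent ends 0 {T : Set (Fin 7) | (5 : Fin 7) ∈ T}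
    let e := clusterInEvent ends 0 {T : Set (Fin 7) | (6 : Fin 7) ∈ T}
    prob (pε ε) (Q ∩ U ∩ e) + prob (pε ε) Q * prob (pε ε) (U ∩ e)
      - prob (pε ε) (Q ∩ U) * prob (pε ε) e - prob (pε ε) (Q ∩ e) * prob (pε ε) U =
      -ε ^ 10 + 16 * ε ^ 11 - 38 * ε ^ 12 + 50 * ε ^ 13 - 53 * ε ^ 14 + 47 * ε ^ 15
        - 36 * ε ^ 16 + 24 * ε ^ 17 - 13 * ε ^ 18 + 6 * ε ^ 19 - 2 * ε ^ 20 := by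
  intro Q U e
  rw [prob_eq_vec ε (mem_inter_iff_and (mem_inter_iff_and mem_Q_iff mem_U_iff) mem_e_iff) cnt_QUE,
    prob_eq_vec ε mem_Q_iff cnt_Q, prob_eq_vec ε (mem_inter_iff_and mem_U_iff mem_e_iff) cnt_UE,
    prob_eq_vec ε (mem_inter_iff_and mem_Q_iff mem_U_iff) cnt_QU, prob_eq_vec ε mem_e_iff cnt_E,
    prob_eq_vec ε (mem_inter_iff_and mem_Q_iff mem_e_iff) cnt_QE, prob_eq_vec ε mem_U_iff cnt_U]
  simp only [Fin.sum_univ_succ, Fin.sum_univ_zero, Matrix.cons_val_zero, Matrix.cons_val_succ,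
    Fin.val_zero, Fin.val_succ]
  norm_num
  ring

/-- **The corner family violates `(T_h)` for every `0 < ε ≤ 1/16`**: with `p = 1 − ε` on the root
edges and `ε` on the others, `P(Q ∩ U ∩ e) + P(Q) P(U ∩ e) < P(Q ∩ U) P(e) + P(Q ∩ e) P(U)`. -/
theorem t_corner_neg (ε : ℚ) (h0 : 0 < ε) (h1 : ε ≤ 1 / 16) :
    let Q := clusterInEvent ends 0 {T : Set (Fin 7) | (1 : Fin 7) ∈ T}
    let U := clusterInEvent ends 0 {T : Set (Fin 7) | (5 : Fin 7) ∈ T}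
    let e := clusterInEvent ends 0 {T : Set (Fin 7) | (6 : Fin 7) ∈ T}
    prob (pε ε) (Q ∩ U ∩ e) + prob (pε ε) Q * prob (pε ε) (U ∩ e) <
      prob (pε ε) (Q ∩ U) * prob (pε ε) e + prob (pε ε) (Q ∩ e) * prob (pε ε) U := by
  intro Q U e
  have h := t_corner_eq ε
  simp only at h
  have hB : 0 < (1 - 16 * ε) + ε ^ 2 * (38 - 50 * ε) + ε ^ 4 * (53 - 47 * ε)
      + ε ^ 6 * (36 - 24 * ε) + ε ^ 8 * (13 - 6 * ε) + 2 * ε ^ 10 := by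
    have h2 : 0 ≤ 1 - 16 * ε := by linarith
    have h3 : 0 < ε ^ 2 * (38 - 50 * ε) := mul_pos (pow_pos h0 2) (by linarith)
    have h4 : 0 < ε ^ 4 * (53 - 47 * ε) := mul_pos (pow_pos h0 4) (by linarith)
    have h5 : 0 < ε ^ 6 * (36 - 24 * ε) := mul_pos (pow_pos h0 6) (by linarith)
    have h6 : 0 < ε ^ 8 * (13 - 6 * ε) := mul_pos (pow_pos h0 8) (by linarith)
    have h7 : 0 < 2 * ε ^ 10 := by positivity
    linarith
  have hT : prob (pε ε) (Q ∩ U ∩ e) + prob (pε ε) Q * prob (pε ε) (U ∩ e)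
      - prob (pε ε) (Q ∩ U) * prob (pε ε) e - prob (pε ε) (Q ∩ e) * prob (pε ε) U =
      -(ε ^ 10 * ((1 - 16 * ε) + ε ^ 2 * (38 - 50 * ε) + ε ^ 4 * (53 - 47 * ε)
        + ε ^ 6 * (36 - 24 * ε) + ε ^ 8 * (13 - 6 * ε) + 2 * ε ^ 10)) := by
    rw [h]; ring
  have hneg : ε ^ 10 * ((1 - 16 * ε) + ε ^ 2 * (38 - 50 * ε) + ε ^ 4 * (53 - 47 * ε)
      + ε ^ 6 * (36 - 24 * ε) + ε ^ 8 * (13 - 6 * ε) + 2 * ε ^ 10) > 0 := mul_pos (pow_pos h0 10) hB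
  linarith

/-- **The dyadic witness**: at `ε = 1/16` (weights `15/16` and `1/16`) the form equals
`−75314579025 / 604462909807314587353088 = −75314579025 / 2⁷⁹`. -/
theorem t_dyadic_eq :
    let Q := clusterInEvent ends 0 {T : Set (Fin 7) | (1 : Fin 7) ∈ T}
    let U := clusterInEvent ends 0 {T : Set (Fin 7) | (5 : Fin 7) ∈ T}
    let e := clusterInEvent ends 0 {T : Set (Fin 7) | (6 : Fin 7) ∈ T}
    prob (pε (1 / 16)) (Q ∩ U ∩ e) + prob (pε (1 / 16)) Q * prob (pε (1 / 16)) (U ∩ e)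
      - prob (pε (1 / 16)) (Q ∩ U) * prob (pε (1 / 16)) e
      - prob (pε (1 / 16)) (Q ∩ e) * prob (pε (1 / 16)) U =
      -75314579025 / 604462909807314587353088 := by
  intro Q U e
  have h := t_corner_eq (1 / 16)
  simp only at h
  rw [h]
  norm_num

end THCornerFamily

end Summit.Ventures.PercRepro2
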